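import Summits.BirchSwinnertonDyer.BirchSwinnertonDyer.Theorems.PrintCf2RamifiedOffTYZGenusCharacter
import Summits.BirchSwinnertonDyer.BirchSwinnertonDyer.Theorems.PrintCf2RamifiedOffTYZLayerOneSilenceOdd
import HarnessLib

/-!
# Route `PrintCf2`, crux stmt-BirchSwinnertonDyer-20509 `RamifiedOffTYZOfFacts` — THE LOWER-HALF DOOR: when `𝓛(n)` is ODD the square of
# every `g ∈ Gal(ℍ′_n/K_n(i))` moves the genus point by EXACTLY the genus character of the half-generator, `g²·P(n) − P(n) = g·Q₁ − Q₁`;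
# hence a HALF-MOVER WITH SILENT SQUARE forces `2 ∣ 𝓛(n)` — and Layer-1 silence (g10) makes every square silent on the odd `s ≥ 2` class:
# **on the odd `s ≥ 2` class with a half-mover, `2 ∣ 𝓛(n)`; on the odd jump-one class with a half-mover, C⁺ ⟺ ONE Galois bit**
# (cell `bsd-print-cf2`, LEAD of 20509 g11, line `offtyz-v7`, lineage cycle 12, sequel of `…GenusCharacter`; fact-free, Theses-free, no `def`)

HONEST FRAMING (crux 20509 = `𝔅_ram → WAllCornerFTwoRamifiedOffTYZProved`, DECIDING, OPEN AS A CLASS): bookkeeping on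
Tian–Yuan–Zhang's Theorem 3.5 main clause and Lemma 3.18 taken as HYPOTHESES on the displayed data (`D.thm35Main`, `D.scriptLSpec`,
`D.lemma318`), GZK by name, g3's `ρ`-free main clause (p665240), g4's Galois motion (p671505), this seat's `…GenusCharacter` (p726538), and —
for §3 — g10's Layer-1 silence theorem `LayerOneSilenceOdd.galPt_sq_genusPoint_eq_of_card_selmer_odd` (p722669) with ITS displayed
hypotheses (CM-point blocks, conductor-2 ring class dictionary, Frobenius clause), Thm 1.1 BY NAME (`thm11_parity_of_scriptL`) and Monsky's
formula (tree theorem).  Nothing is asserted; C⁺ = `stub_offTYZ_levelTwoScriptLExact` (= item stmt-BirchSwinnertonDyer-23431) stays open.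

Notation (written out, no `def`): `c_P(g) := g·P(n) − P(n)`; `Q₁` a half of the twisted Mordell–Weil generator (`φ_H(Q₁) = ι Θ_E(R)`);
`χ_{Q₁}(g) := g·Q₁ − Q₁ ∈ {0, τ(1)}`; a HALF-MOVER is a `g₀ ∈ Aut_ℚ(ℍ′_n)` fixing `i` and `√−n` with `g₀·Q₁ ≠ Q₁` (one exists iff
`ρ(n) = 1`, i.e. iff `x(R) ∉ {±1, ±n}·ℚ^{×2}`, by Galois theory on `K_n(i, Q₁) = K_n(i, √X(ιΘ_E R))` — kernel-owed, taken as a hypothesis).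

* §1 **`galPt_sq_genusPoint_sub_eq_galPt_half_sub_of_odd_scriptL`** (square-free ODD `n`, `rank E_n(ℚ) ≤ 1`, `𝓛(n)` ODD, Thm 3.5, Lemma
  3.18): for every `g` fixing `i` and `√−n`, **`g²·P(n) − P(n) = g·Q₁ − Q₁`**.  (`𝓛 = 2j+1`: `Q₁ = 2y − t′` with `y = u·P − j·Q₁`; apply
  `g − 1`: `χ(g) = 2(gy − y) = 2u·c_P(g) = c_P(g²)`, the last step by `…GenusCharacter` §2.)  So when `𝓛(n)` is odd the square-mover
  character of g4–g10 IS the half-generator's genus character: squares move `P(n)` exactly at the `g` detecting the `φ`-class of `R`.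
* §2 **`two_dvd_scriptL_of_halfMover_of_sq_eq`** (the class: square-free odd `n ≡ 5, 7 (mod 8)`, `r_an = 1`, GZK, Thm 3.5, integrality, Lemma
  3.18): a half-mover `g₀` whose square FIXES `P(n)` forces **`2 ∣ L` for every sign choice `L` of `𝓛(n)`** — a door for the LOWER half of C⁺
  (the half with no door so far).  With `…GenusCharacter` §4: **`levelTwo_iff_galPt_genusPoint_ne_of_halfMover_of_sq_eq` — then C⁺ at `n` ⟺
  `g₀·P(n) ≠ P(n)`**, one bit, no half assumed.
* §3 **`two_dvd_scriptL_of_halfMover_of_card_selmer_odd`**: plug in g10's silence (`n = p₁⋯p_k`, displays, Thm 1.1, `#Sel₂(E_n) = 2^{2+s}`,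
  `s ≥ 2`): **a half-mover forces `2 ∣ 𝓛(n)` on the whole odd `s ≥ 2` class** — the Ш-side / Kolyvagin-inequality direction of BSD₂
  («`Sel₂` excess ⟹ `𝓛(n)` even») on the stratum `{ρ(n) = 1}`, relative to the displays; and
  **`levelTwo_iff_galPt_genusPoint_ne_of_halfMover_of_card_selmer_thirtytwo_odd`: on the odd jump-one class (`#Sel₂ = 2⁵`; `#Sel₄` not used)
  with a half-mover `g₀`, C⁺ at `n` ⟺ `g₀·P(n) ≠ P(n)`.**

What this buys the line (LEAD census, crux 20509): the FIRST digit theorem on part of the `s ≥ 2` class — TYZ Thm 1.2 reads «genus sums odd ⟹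
`2^{−ρ}𝓛` odd»; here «`s ≥ 2` ∧ half-mover ⟹ `𝓛` even», the converse direction BSD₂ demands, on `{ρ = 1}`.  Together with
`…GenusCharacterRho` (on `{ρ = 0}` the lower-half locus has `P(n)` fixed by all of `Gal(ℍ′_n/K_n(i))`) the odd jump-one class splits by the
descent invariant `ρ(n)`: `{ρ = 1}`: lower half PROVED (mod displays), C⁺ ⟺ `c_P(g₀) ≠ 0` (BSD₂ predicts `= τ(1)`); `{ρ = 0}`: both halves
invisible to `Gal(ℍ′_n/K_n(i))`.  Beyond-print theorem: §3's lower half on `{ρ = 1} ∩ {s ≥ 2}` is not in print as far as the lineage's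
presearch reaches (TYZ decide `𝓛 mod 2` only in the direction «sums odd ⟹ odd»); it is CONDITIONAL on the displayed statements and Thm 1.1
exactly as g10's silence is.  C⁺ stays open; BSD is not proved by any of this; no class is closed by this file.

References: [cite: TianYuanZhang2017, Thm. 3.5 (p0011 L94–L100), Lemma 3.16 (p0017 L98–L113), Lemma 3.18 (p0017 L152–L153), §3.1 (p0011
L27–L73), Thm. 1.1/1.2 (p0002 L90–L127)]; [cite: HeathBrown1994SelmerCongruentII, Appendix (Monsky)]; [cite: SilvermanAEC2009, X.4.9];
[cite: Darmon2004, Thm. 3.22] (GZK); tree: `…GenusCharacter` (p726538), `…LayerOneSilenceOdd` (p722669), `…GaloisMotion` (p671505),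
`…LevelTwoHalfGenerator` (p665240).
-/

noncomputable section

open scoped Classical

open WeierstrassCurve WeierstrassCurve.Affine Literature.NumberTheory.EllipticCurves
  Literature.NumberTheory.EllipticCurves.Rank1Residual Summit.BirchSwinnertonDyer.Rank1Residual
  Literature.NumberTheory.EllipticCurves.TianYuanZhang2017
  Literature.NumberTheory.EllipticCurves.TianYuanZhang2017.W2
  Summit.BirchSwinnertonDyer.PrintCf2.LevelTwoHalfGenerator
  Summit.BirchSwinnertonDyer.PrintCf2.GaloisMotion
  Summit.BirchSwinnertonDyer.PrintCf2.LevelTwoHalves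
  Summit.BirchSwinnertonDyer.PrintCf2.LevelTwoGenusQuotient
  Summit.BirchSwinnertonDyer.PrintCf2.GenusCharacter
  Summit.BirchSwinnertonDyer.Rank1Residual.P2.ThetaDescent

set_option autoImplicit false

namespace Summit.BirchSwinnertonDyer.PrintCf2

namespace LowerHalfDoor

variable {n : ℕ}

/-! ## §1 `𝓛(n)` odd ⟹ `g²·P(n) − P(n) = g·Q₁ − Q₁` on the stabiliser of `i` and `√−n` -/

/-- **WHEN `𝓛(n)` IS ODD, THE SQUARE-MOVER CHARACTER IS THE HALF-GENERATOR'S GENUS CHARACTER.**  Square-free ODD `n` with `rank E_n(ℚ) ≤ 1`;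
data `D` with Thm 3.5's displayed main clause and Lemma 3.18; `𝓛(n)` odd (the data's sign choice); `R` a generator of `E_n(ℚ)` mod torsion,
`Q₁` a half of its twist.  Then for every `g ∈ Aut_ℚ(ℍ′_n)` fixing `i` and `√−n`: `g²·P(n) − P(n) = g·Q₁ − Q₁`.
[cite: TianYuanZhang2017, Thm. 3.5 (p0011 L94–L100), Lemma 3.18 (p0017 L152–L153)] -/
theorem galPt_sq_genusPoint_sub_eq_galPt_half_sub_of_odd_scriptL (hsq : Squarefree n) [(congruentNumberCurve n).IsElliptic]
    (hodd : Odd n) (hr1 : (congruentNumberCurve n).mordellWeilRank ≤ 1) (D : GenusPointData n) (h35 : D.thm35Main)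
    (h318 : D.lemma318) (hLodd : Odd (D.scriptL n))
    {R : (congruentNumberCurve n).toAffine.Point} (hR : ∀ x, ∃ k : ℤ, IsOfFinAddOrder (x - k • R))
    {Q₁ : APoint D.H} (hQ₁ : φH D Q₁ = Point.map (W' := curveA.twoIsogenyCodomain)
      (D.embK n (Nat.mem_divisors_self n hsq.ne_zero)) (ΘE hsq.ne_zero R))
    (g : D.H ≃ₐ[ℚ] D.H) (hgi : g D.im = D.im) (hgK : g (D.sqrtNeg n) = D.sqrtNeg n) :
    D.galPt (g * g) (D.P n) - D.P n = D.galPt g Q₁ - Q₁ := by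
  have hn : n ∈ n.divisors := Nat.mem_divisors_self n hsq.ne_zero
  have hL0 : D.scriptL n ≠ 0 := by obtain ⟨j, hj⟩ := hLodd; omega
  obtain ⟨u, hu, hrel⟩ := two_smul_genusPoint_sub_smul_half_isOfFinAddOrder hsq hr1 D h35 hL0 hR hQ₁
  have hu2 : u * u = 1 := by rcases hu with rfl | rfl <;> norm_num
  obtain ⟨j, hj⟩ := hLodd
  -- `t′ := 2y − Q₁` is torsion for `y = uP − jQ₁`
  have ht : IsOfFinAddOrder ((2 : ℤ) • (u • D.P n - j • Q₁) - Q₁) := by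
    have e : (2 : ℤ) • (u • D.P n - j • Q₁) - Q₁ = u • ((2 : ℤ) • D.P n - (u * D.scriptL n) • Q₁) := by
      rw [hj]
      rcases hu with rfl | rfl <;> module
    rw [e]
    exact hrel.zsmul
  have hfix : D.galPt g ((2 : ℤ) • (u • D.P n - j • Q₁) - Q₁) = (2 : ℤ) • (u • D.P n - j • Q₁) - Q₁ :=
    galPt_eq_self_of_isOfFinAddOrder D hodd h318 g hgi ht
  -- `χ(g) = 2u·c_P(g) − 2j·χ(g)` and `2χ(g) = 0`
  have h2χ : (2 : ℤ) • (D.galPt g Q₁ - Q₁) = 0 := by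
    rcases galPt_half_sub_eq_zero_or_eq_tauOne D hn g hgK hQ₁ with e | e
    · rw [e, smul_zero]
    · rw [e, two_zsmul, ← two_nsmul, two_nsmul_tauOne]
  have key : D.galPt g Q₁ - Q₁ = u • ((2 : ℤ) • (D.galPt g (D.P n) - D.P n)) := by
    have e1 : D.galPt g Q₁ - Q₁ =
        (2 : ℤ) • (u • (D.galPt g (D.P n) - D.P n)) - j • ((2 : ℤ) • (D.galPt g Q₁ - Q₁))
          - (D.galPt g ((2 : ℤ) • (u • D.P n - j • Q₁) - Q₁) - ((2 : ℤ) • (u • D.P n - j • Q₁) - Q₁)) := by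
      rw [map_sub, map_zsmul, map_sub, map_zsmul, map_zsmul]; module
    rw [e1, hfix, sub_self, sub_zero, h2χ, smul_zero, sub_zero]; module
  -- `χ(g) ∈ {0, τ(1)}` is its own negative, so `2•c_P(g) = u•χ(g) = χ(g)`
  have hχneg : -(D.galPt g Q₁ - Q₁) = D.galPt g Q₁ - Q₁ := by
    rcases galPt_half_sub_eq_zero_or_eq_tauOne D hn g hgK hQ₁ with e | e
    · rw [e, neg_zero]
    · rw [e, neg_eq_iff_add_eq_zero, ← two_nsmul, two_nsmul_tauOne]
  have hx : (2 : ℤ) • (D.galPt g (D.P n) - D.P n) = u • (D.galPt g Q₁ - Q₁) := by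
    rw [key, smul_smul, hu2, one_smul]
  rw [← two_smul_galPt_genusPoint_sub hsq hodd hr1 D h35 hL0 h318 g hgi hgK, ← ofNat_zsmul, hx]
  rcases hu with rfl | rfl
  · rw [one_smul]
  · rw [neg_one_smul, hχneg]

/-! ## §2 The lower-half door: a half-mover with silent square forces `2 ∣ 𝓛(n)` -/

/-- **THE LOWER-HALF DOOR.**  Square-free ODD `n ≡ 5, 7 (mod 8)` with `ord_{s=1} L(E_n, s) = 1`; GZK; data `D` with Thm 3.5's displayed main
clause, integrality and Lemma 3.18; `R` a generator of `E_n(ℚ)` modulo torsion, `Q₁` a half of its twist.  If some `g₀ ∈ Aut_ℚ(ℍ′_n)` fixing `i`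
and `√−n` MOVES `Q₁` while its SQUARE FIXES `P(n)`, then `2 ∣ L` for every integer `L` with `𝓛(n)² = L²`.
[cite: TianYuanZhang2017, Thm. 3.5 (p0011 L94–L100), Lemma 3.18 (p0017 L152–L153)] [cite: Darmon2004, Thm. 3.22] -/
theorem two_dvd_scriptL_of_halfMover_of_sq_eq
    (hGZK : rank_eq_analyticRank_of_analyticRank_le_one) (hsq : Squarefree n)
    (h8 : n % 8 = 5 ∨ n % 8 = 7) (hr : (congruentNumberCurve n).analyticRank = 1)
    (D : GenusPointData n) (h35 : D.thm35Main) (hLs : D.scriptLSpec) (h318 : D.lemma318)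
    {R : (congruentNumberCurve n).toAffine.Point} (hR : ∀ x, ∃ k : ℤ, IsOfFinAddOrder (x - k • R))
    {Q₁ : APoint D.H} (hQ₁ : φH D Q₁ = Point.map (W' := curveA.twoIsogenyCodomain)
      (D.embK n (Nat.mem_divisors_self n hsq.ne_zero)) (ΘE hsq.ne_zero R))
    (g₀ : D.H ≃ₐ[ℚ] D.H) (hgi : g₀ D.im = D.im) (hgK : g₀ (D.sqrtNeg n) = D.sqrtNeg n)
    (hmoveQ : D.galPt g₀ Q₁ ≠ Q₁) (hsq0 : D.galPt (g₀ * g₀) (D.P n) = D.P n) :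
    ∀ L : ℤ, IsScriptL n L → (2 : ℤ) ∣ L := by
  haveI := isElliptic_congruentNumberCurve hsq.ne_zero
  have hodd : Odd n := by rcases h8 with h | h <;> exact Nat.odd_iff.mpr (by omega)
  have hn : n ∈ n.divisors := Nat.mem_divisors_self n hsq.ne_zero
  have hn1 : 1 < n := by rcases h8 with h | h <;> omega
  have hLD : IsScriptL n (D.scriptL n) := hLs n hn hn1
  have hrank : (congruentNumberCurve n).mordellWeilRank = 1 := (hGZK _ hr.le).1.trans hr
  have h2 : (2 : ℤ) ∣ D.scriptL n := by
    by_contra hnot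
    have hLodd : Odd (D.scriptL n) := Int.not_even_iff_odd.mp (fun h => hnot (even_iff_two_dvd.mp h))
    apply hmoveQ
    have key := galPt_sq_genusPoint_sub_eq_galPt_half_sub_of_odd_scriptL hsq hodd hrank.le D h35 h318 hLodd hR hQ₁ g₀ hgi hgK
    rw [hsq0, sub_self] at key
    exact (sub_eq_zero.mp key.symm)
  intro L hL
  rcases LevelTwo.eq_or_eq_neg_of_isScriptL hL hLD with rfl | rfl
  · exact h2
  · exact (dvd_neg).mpr h2

/-- **HALF-MOVER WITH SILENT SQUARE: C⁺ AT `n` ⟺ ONE BIT** (same data): the conclusion of C⁺ at `n` holds iff `g₀·P(n) ≠ P(n)` — the lower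
half by the door above, the equivalence by `…GenusCharacter` §4. [cite: TianYuanZhang2017, Thm. 3.5 (p0011 L94–L100), Lemma 3.18 (p0017 L152–L153)] [cite: Darmon2004, Thm. 3.22] -/
theorem levelTwo_iff_galPt_genusPoint_ne_of_halfMover_of_sq_eq
    (hGZK : rank_eq_analyticRank_of_analyticRank_le_one) (hsq : Squarefree n)
    (h8 : n % 8 = 5 ∨ n % 8 = 7) (hr : (congruentNumberCurve n).analyticRank = 1)
    (D : GenusPointData n) (h35 : D.thm35Main) (hLs : D.scriptLSpec) (h318 : D.lemma318)
    {R : (congruentNumberCurve n).toAffine.Point} (hR : ∀ x, ∃ k : ℤ, IsOfFinAddOrder (x - k • R))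
    {Q₁ : APoint D.H} (hQ₁ : φH D Q₁ = Point.map (W' := curveA.twoIsogenyCodomain)
      (D.embK n (Nat.mem_divisors_self n hsq.ne_zero)) (ΘE hsq.ne_zero R))
    (g₀ : D.H ≃ₐ[ℚ] D.H) (hgi : g₀ D.im = D.im) (hgK : g₀ (D.sqrtNeg n) = D.sqrtNeg n)
    (hmoveQ : D.galPt g₀ Q₁ ≠ Q₁) (hsq0 : D.galPt (g₀ * g₀) (D.P n) = D.P n) :
    (∀ L : ℤ, IsScriptL n L → (2 : ℤ) ∣ L ∧ ¬ (4 : ℤ) ∣ L) ↔ D.galPt g₀ (D.P n) ≠ D.P n :=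
  levelTwo_iff_galPt_genusPoint_ne_of_two_dvd hGZK hsq h8 hr D h35 hLs h318 hR hQ₁
    (two_dvd_scriptL_of_halfMover_of_sq_eq hGZK hsq h8 hr D h35 hLs h318 hR hQ₁ g₀ hgi hgK hmoveQ hsq0) g₀ hgi hgK hmoveQ

end LowerHalfDoor

/-! ## §3 With g10's Layer-1 silence: on the odd `s ≥ 2` class a half-mover forces `2 ∣ 𝓛(n)` -/

namespace LowerHalfDoor

open Finset Matrix Literature.NumberTheory.EllipticCurves.HeathBrown1994 Literature.NumberTheory.EllipticCurves.Smith2016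
  Literature.NumberTheory.QuadraticFields.RingClass Literature.NumberTheory.QuadraticFields
  Summit.BirchSwinnertonDyer.PrintCf2.QForm Summit.BirchSwinnertonDyer.PrintCf2.QFormForest
  Summit.BirchSwinnertonDyer.PrintCf2.MoverAssembly Summit.BirchSwinnertonDyer.PrintCf2.LayerOneSilence
  Summit.BirchSwinnertonDyer.PrintCf2.LayerOneSilenceOdd

variable {k : ℕ} (p : Fin k → ℕ) (hp : ∀ i, (p i).Prime) (hpodd : ∀ i, Odd (p i)) (hinj : Function.Injective p)
variable {n : ℕ} (D : GenusPointData n)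

include hp hpodd hinj in
/-- **ON THE ODD `s ≥ 2` CLASS A HALF-MOVER FORCES `2 ∣ 𝓛(n)`.**  `n = p₁⋯p_k` square-free, `n ≡ 5` or `7 (mod 8)`, `ord_{s=1} L(E_n, s) = 1`,
GZK; the displayed recursion, sign choices, Thm 3.5 main clause, Lemma 3.18; the CM-point layer, conductor-2 ring class dictionary and Frobenius
clause on every block (g10's hypotheses, verbatim); Thm 1.1 BY NAME; `#Sel₂(E_n/ℚ) = 2^{2+s}` with `s ≥ 2`; `R` a generator of `E_n(ℚ)` mod
torsion, `Q₁` a half of its twist, and a half-mover `g₀` (fixing `i`, `√−n`, moving `Q₁`).  Then `2 ∣ L` for every integer `L` with `𝓛(n)² = L²`.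
(The square `g₀²` is silent by g10; §2.)
[cite: TianYuanZhang2017, Thm. 3.5 (p0011 L94–L100), §3.1 (p0011 L53–L73), Thm. 3.6 (1), proof of Lemma 3.21 (p0020 L27–L63), Thm. 1.1]
[cite: HeathBrown1994SelmerCongruentII, Appendix (Monsky), typescript p. 39 L10–L41] [cite: Darmon2004, Thm. 3.22] -/
theorem two_dvd_scriptL_of_halfMover_of_card_selmer_odd
    (hGZK : rank_eq_analyticRank_of_analyticRank_le_one) (hsqf : Squarefree n) (hn : n = ∏ i, p i)
    (h57 : n % 8 = 5 ∨ n % 8 = 7) (hr : (congruentNumberCurve n).analyticRank = 1)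
    (hrec : D.recursion) (hLs : D.scriptLSpec) (h35 : D.thm35Main) (h318 : D.lemma318)
    (z : ℕ → APoint D.H) (Φ : ℕ → Finset (D.H ≃ₐ[ℚ] D.H)) (ΓH ΓH' : ℕ → Subgroup (D.H ≃ₐ[ℚ] D.H))
    (σ : ℕ → (D.H ≃ₐ[ℚ] D.H)) (c : D.H ≃ₐ[ℚ] D.H) (ρ : (d : ℕ) → (D.galK d →* RingClassGroup (GenusField d) 2))
    (hc : D.ConjSpec c)
    (hblock : ∀ d ∈ n.divisors, ((d % 8 = 5 ∨ d % 8 = 6) → D.CMBlockSpec d (z d) (Φ d) (ΓH d) (ΓH' d) (σ d) c) ∧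
      (d % 8 = 7 → D.SevenBlockSpec d))
    (hring : ∀ d ∈ n.divisors, d % 8 = 5 → D.RingClassTwoBlockSpec d (ΓH d) (ΓH' d) (ρ d))
    (hFrob : ∀ d ∈ n.divisors, d % 8 = 5 → ∀ q : ℕ, q.Prime → q ∣ d → ∃ φ : D.H ≃ₐ[ℚ] D.H,
      φ (D.sqrtNeg d) = D.sqrtNeg d ∧ φ * φ ∈ ΓH' d ∧ φ D.im = (jacobiSym (-1) q) • D.im ∧
        ∀ r : ℕ, r.Prime → r ∣ n → r ≠ q → φ (D.sqrtNeg r) = (jacobiSym (-(r : ℤ)) q) • D.sqrtNeg r)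
    (h11 : thm11_parity_of_scriptL) {s : ℕ} (hs : 2 ≤ s)
    (hsel : Nat.card ((congruentNumberCurve n).selmerGroup 2) = 2 ^ (2 + s))
    {R : (congruentNumberCurve n).toAffine.Point} (hR : ∀ x, ∃ k : ℤ, IsOfFinAddOrder (x - k • R))
    {Q₁ : APoint D.H} (hQ₁ : φH D Q₁ = Point.map (W' := curveA.twoIsogenyCodomain)
      (D.embK n (Nat.mem_divisors_self n hsqf.ne_zero)) (ΘE hsqf.ne_zero R))
    (g₀ : D.H ≃ₐ[ℚ] D.H) (hgi : g₀ D.im = D.im) (hgK : g₀ (D.sqrtNeg n) = D.sqrtNeg n)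
    (hmoveQ : D.galPt g₀ Q₁ ≠ Q₁) :
    ∀ L : ℤ, IsScriptL n L → (2 : ℤ) ∣ L :=
  two_dvd_scriptL_of_halfMover_of_sq_eq hGZK hsqf h57 hr D h35 hLs h318 hR hQ₁ g₀ hgi hgK hmoveQ
    (galPt_sq_genusPoint_eq_of_card_selmer_odd p hp hpodd hinj D hn h57 hrec hLs z Φ ΓH ΓH' σ c ρ hc hblock hring hFrob h11
      hs hsel g₀)

include hp hpodd hinj in
/-- **ON THE ODD JUMP-ONE CLASS WITH A HALF-MOVER, C⁺ IS ONE GALOIS BIT.**  Same data with `#Sel₂(E_n/ℚ) = 2⁵` (the class of C⁺ = item 23431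
restricted to odd `n`; `#Sel₄` is not used): the conclusion of C⁺ at `n` holds **iff `g₀·P(n) ≠ P(n)`** (lower half from the silence of `g₀²`,
upper half from g4's door). [cite: TianYuanZhang2017, Thm. 3.5 (p0011 L94–L100), §3.1 (p0011 L53–L73), Thm. 3.6 (1), Thm. 1.1]
[cite: HeathBrown1994SelmerCongruentII, Appendix (Monsky), typescript p. 39 L10–L41] [cite: Darmon2004, Thm. 3.22] -/
theorem levelTwo_iff_galPt_genusPoint_ne_of_halfMover_of_card_selmer_thirtytwo_odd
    (hGZK : rank_eq_analyticRank_of_analyticRank_le_one) (hsqf : Squarefree n) (hn : n = ∏ i, p i)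
    (h57 : n % 8 = 5 ∨ n % 8 = 7) (hr : (congruentNumberCurve n).analyticRank = 1)
    (hrec : D.recursion) (hLs : D.scriptLSpec) (h35 : D.thm35Main) (h318 : D.lemma318)
    (z : ℕ → APoint D.H) (Φ : ℕ → Finset (D.H ≃ₐ[ℚ] D.H)) (ΓH ΓH' : ℕ → Subgroup (D.H ≃ₐ[ℚ] D.H))
    (σ : ℕ → (D.H ≃ₐ[ℚ] D.H)) (c : D.H ≃ₐ[ℚ] D.H) (ρ : (d : ℕ) → (D.galK d →* RingClassGroup (GenusField d) 2))
    (hc : D.ConjSpec c)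
    (hblock : ∀ d ∈ n.divisors, ((d % 8 = 5 ∨ d % 8 = 6) → D.CMBlockSpec d (z d) (Φ d) (ΓH d) (ΓH' d) (σ d) c) ∧
      (d % 8 = 7 → D.SevenBlockSpec d))
    (hring : ∀ d ∈ n.divisors, d % 8 = 5 → D.RingClassTwoBlockSpec d (ΓH d) (ΓH' d) (ρ d))
    (hFrob : ∀ d ∈ n.divisors, d % 8 = 5 → ∀ q : ℕ, q.Prime → q ∣ d → ∃ φ : D.H ≃ₐ[ℚ] D.H,
      φ (D.sqrtNeg d) = D.sqrtNeg d ∧ φ * φ ∈ ΓH' d ∧ φ D.im = (jacobiSym (-1) q) • D.im ∧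
        ∀ r : ℕ, r.Prime → r ∣ n → r ≠ q → φ (D.sqrtNeg r) = (jacobiSym (-(r : ℤ)) q) • D.sqrtNeg r)
    (h11 : thm11_parity_of_scriptL)
    (hsel : Nat.card ((congruentNumberCurve n).selmerGroup 2) = 2 ^ 5)
    {R : (congruentNumberCurve n).toAffine.Point} (hR : ∀ x, ∃ k : ℤ, IsOfFinAddOrder (x - k • R))
    {Q₁ : APoint D.H} (hQ₁ : φH D Q₁ = Point.map (W' := curveA.twoIsogenyCodomain)
      (D.embK n (Nat.mem_divisors_self n hsqf.ne_zero)) (ΘE hsqf.ne_zero R))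
    (g₀ : D.H ≃ₐ[ℚ] D.H) (hgi : g₀ D.im = D.im) (hgK : g₀ (D.sqrtNeg n) = D.sqrtNeg n)
    (hmoveQ : D.galPt g₀ Q₁ ≠ Q₁) :
    (∀ L : ℤ, IsScriptL n L → (2 : ℤ) ∣ L ∧ ¬ (4 : ℤ) ∣ L) ↔ D.galPt g₀ (D.P n) ≠ D.P n :=
  levelTwo_iff_galPt_genusPoint_ne_of_halfMover_of_sq_eq hGZK hsqf h57 hr D h35 hLs h318 hR hQ₁ g₀ hgi hgK hmoveQ
    (galPt_sq_genusPoint_eq_of_card_selmer_thirtytwo_odd p hp hpodd hinj D hn h57 hrec hLs z Φ ΓH ΓH' σ c ρ hc hblock hring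
      hFrob h11 hsel g₀)

end LowerHalfDoor

end Summit.BirchSwinnertonDyer.PrintCf2

end
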